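import Literature.Computability.QuantumComplexity.ForrelationThm25Bricks
import HarnessLib

/-!
# Aaronson–Ambainis Theorem 25 in `FP`, III: the interpreter of the token stream (gate loop)

Topic `Literature/Computability/QuantumComplexity`; third file towards the residual named fact
`AaronsonAmbainis2018_thm25_sign_encodeFP` (`ForrelationThm25Sign.lean`; S. Aaronson,
A. Ambainis, *Forrelation*, SIAM J. Comput. 47 (2018) = arXiv:1411.5729, §6, Thm. 25, proof
p. 27: the reduction QSIM `→` FORRELATION is a gate-by-gate transcription). The lexer of
`ForrelationThm25Lexer.lean` turns the code of a QSIM instance into `1ⁿ 0` followed by three-bit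
tokens (wire-numeral bits, end-of-numeral, gate kind, in postfix order); this file is the main
loop of the structured stack program (`Com`, `StackPrograms.lean`) that prints, gate by gate, the
list elements of the shapes of `ForrelationThm25Sign.blockS` (`shapeBits`, `codeTwoL`, … of
`ForrelationThm25Bricks.lean`), in the register conventions of `TokenStreams.lean` (`TokConv`):

* the registers `R`, states `St` (register contents by name) with `St.regs`;
* the handlers of the eight tokens (`handler`): a numeral bit is pushed on the accumulator `wa`;
  end-of-numeral pours `wa` into the next free wire slot `w1`, `w2`, `w3` (`commit`); a kind
  token prints its block — `H`: the triple of CSIGN gadgets on the wire and the two dummies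
  (`triple`), `Z`/`CZ`/`CCZ`: separator, phase shape, separator, and the separator closing the
  block, oracle: the identity block — counts the printed shapes in unary on `ku`, the Hadamard
  gates on `hu`, raises the oracle flag `fo`, and clears the slots (`cleanup`);
* their functional models on `St` (`actM`, …) with exact register effects and linear step
  bounds (`runs_handler`), the invariant `Inv`, and **the gate loop on every bit stream**
  (`gateLoop`, `loopM`, `runs_gateLoop`: dispatch on three bits until the stream is exhausted,
  quadratic cost), after `TokConv.runs_mainLoop`.

The prefix, the tail (odd case, finishing gadget), the header and the `FP` statement are in the
sequel.

## References

* S. Aaronson, A. Ambainis, *Forrelation: a problem that optimally separates quantum from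
  classical computing*, SIAM J. Comput. 47 (2018) 982–1038; arXiv:1411.5729, §6, Thm. 25.
* S. Arora, B. Barak, *Computational Complexity: A Modern Approach*, CUP 2009, §1.3, §6.1.
* T. Nipkow, G. Klein, *Concrete Semantics with Isabelle/HOL*, Springer 2014, Ch. 7–8.
-/

namespace Literature.Computability.QuantumComplexity

open _root_.Computability Complexity Complexity.Com Cryptography Thm25Lex

namespace Thm25Asm

/-! ### Registers and states -/

/-- The registers of the interpreter: input, unary `n`/`n'` and its copies, token stream,
wire accumulator and the three wire slots with their fill flags, the dummy numerals, the numeral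
of `N`, reversed body, unary shape count, unary Hadamard count, oracle flag, binary `k`, the wire
counter of the odd tail, the two bits of the counter modulo `4`, scratch registers, the carry flag,
and the result. [folklore] -/
inductive R
  | inp | u | u2 | uc | g | wa | w1 | w2 | w3 | f1 | f2 | d1 | d2 | nb | o | ku | hu | fo | k | ac | p0 | p1 | t | t2 | c | res
  deriving DecidableEq, Fintype

/-- The contents of the registers, by name. [folklore] -/
structure St where
  /-- register `inp` -/
  inp : List Bool
  /-- register `u` -/
  u : List Bool
  /-- register `u2` -/
  u2 : List Bool
  /-- register `uc` -/
  uc : List Bool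
  /-- register `g` -/
  g : List Bool
  /-- register `wa` -/
  wa : List Bool
  /-- register `w1` -/
  w1 : List Bool
  /-- register `w2` -/
  w2 : List Bool
  /-- register `w3` -/
  w3 : List Bool
  /-- register `f1` -/
  f1 : List Bool
  /-- register `f2` -/
  f2 : List Bool
  /-- register `d1` -/
  d1 : List Bool
  /-- register `d2` -/
  d2 : List Bool
  /-- register `nb` -/
  nb : List Bool
  /-- register `o` -/
  o : List Bool
  /-- register `ku` -/
  ku : List Bool
  /-- register `hu` -/
  hu : List Bool
  /-- register `fo` -/
  fo : List Bool
  /-- register `k` -/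
  k : List Bool
  /-- register `ac` -/
  ac : List Bool
  /-- register `p0` -/
  p0 : List Bool
  /-- register `p1` -/
  p1 : List Bool
  /-- register `t` -/
  t : List Bool
  /-- register `t2` -/
  t2 : List Bool
  /-- register `c` -/
  c : List Bool
  /-- register `res` -/
  res : List Bool

namespace St

/-- The register file of a state. [folklore] -/
def regs (s : St) : Regs R
  | .inp => s.inp
  | .u => s.u
  | .u2 => s.u2
  | .uc => s.uc
  | .g => s.g
  | .wa => s.wa
  | .w1 => s.w1
  | .w2 => s.w2
  | .w3 => s.w3
  | .f1 => s.f1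
  | .f2 => s.f2
  | .d1 => s.d1
  | .d2 => s.d2
  | .nb => s.nb
  | .o => s.o
  | .ku => s.ku
  | .hu => s.hu
  | .fo => s.fo
  | .k => s.k
  | .ac => s.ac
  | .p0 => s.p0
  | .p1 => s.p1
  | .t => s.t
  | .t2 => s.t2
  | .c => s.c
  | .res => s.res

section Lemmas
variable (s : St) (v : List Bool)

/-- Reading `inp`. [folklore] -/ @[simp] theorem regs_inp : s.regs .inp = s.inp := rfl
/-- Reading `u`. [folklore] -/ @[simp] theorem regs_u : s.regs .u = s.u := rfl
/-- Reading `u2`. [folklore] -/ @[simp] theorem regs_u2 : s.regs .u2 = s.u2 := rfl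
/-- Reading `uc`. [folklore] -/ @[simp] theorem regs_uc : s.regs .uc = s.uc := rfl
/-- Reading `g`. [folklore] -/ @[simp] theorem regs_g : s.regs .g = s.g := rfl
/-- Reading `wa`. [folklore] -/ @[simp] theorem regs_wa : s.regs .wa = s.wa := rfl
/-- Reading `w1`. [folklore] -/ @[simp] theorem regs_w1 : s.regs .w1 = s.w1 := rfl
/-- Reading `w2`. [folklore] -/ @[simp] theorem regs_w2 : s.regs .w2 = s.w2 := rfl
/-- Reading `w3`. [folklore] -/ @[simp] theorem regs_w3 : s.regs .w3 = s.w3 := rfl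
/-- Reading `f1`. [folklore] -/ @[simp] theorem regs_f1 : s.regs .f1 = s.f1 := rfl
/-- Reading `f2`. [folklore] -/ @[simp] theorem regs_f2 : s.regs .f2 = s.f2 := rfl
/-- Reading `d1`. [folklore] -/ @[simp] theorem regs_d1 : s.regs .d1 = s.d1 := rfl
/-- Reading `d2`. [folklore] -/ @[simp] theorem regs_d2 : s.regs .d2 = s.d2 := rfl
/-- Reading `nb`. [folklore] -/ @[simp] theorem regs_nb : s.regs .nb = s.nb := rfl
/-- Reading `o`. [folklore] -/ @[simp] theorem regs_o : s.regs .o = s.o := rfl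
/-- Reading `ku`. [folklore] -/ @[simp] theorem regs_ku : s.regs .ku = s.ku := rfl
/-- Reading `hu`. [folklore] -/ @[simp] theorem regs_hu : s.regs .hu = s.hu := rfl
/-- Reading `fo`. [folklore] -/ @[simp] theorem regs_fo : s.regs .fo = s.fo := rfl
/-- Reading `k`. [folklore] -/ @[simp] theorem regs_k : s.regs .k = s.k := rfl
/-- Reading `ac`. [folklore] -/ @[simp] theorem regs_ac : s.regs .ac = s.ac := rfl
/-- Reading `p0`. [folklore] -/ @[simp] theorem regs_p0 : s.regs .p0 = s.p0 := rfl
/-- Reading `p1`. [folklore] -/ @[simp] theorem regs_p1 : s.regs .p1 = s.p1 := rfl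
/-- Reading `t`. [folklore] -/ @[simp] theorem regs_t : s.regs .t = s.t := rfl
/-- Reading `t2`. [folklore] -/ @[simp] theorem regs_t2 : s.regs .t2 = s.t2 := rfl
/-- Reading `c`. [folklore] -/ @[simp] theorem regs_c : s.regs .c = s.c := rfl
/-- Reading `res`. [folklore] -/ @[simp] theorem regs_res : s.regs .res = s.res := rfl
/-- Writing `inp`. [folklore] -/
theorem upd_inp : Function.update s.regs .inp v = { s with inp := v }.regs := by
  funext i; cases i <;> rfl
/-- Writing `u`. [folklore] -/
theorem upd_u : Function.update s.regs .u v = { s with u := v }.regs := by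
  funext i; cases i <;> rfl
/-- Writing `u2`. [folklore] -/
theorem upd_u2 : Function.update s.regs .u2 v = { s with u2 := v }.regs := by
  funext i; cases i <;> rfl
/-- Writing `uc`. [folklore] -/
theorem upd_uc : Function.update s.regs .uc v = { s with uc := v }.regs := by
  funext i; cases i <;> rfl
/-- Writing `g`. [folklore] -/
theorem upd_g : Function.update s.regs .g v = { s with g := v }.regs := by
  funext i; cases i <;> rfl
/-- Writing `wa`. [folklore] -/
theorem upd_wa : Function.update s.regs .wa v = { s with wa := v }.regs := by
  funext i; cases i <;> rfl
/-- Writing `w1`. [folklore] -/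
theorem upd_w1 : Function.update s.regs .w1 v = { s with w1 := v }.regs := by
  funext i; cases i <;> rfl
/-- Writing `w2`. [folklore] -/
theorem upd_w2 : Function.update s.regs .w2 v = { s with w2 := v }.regs := by
  funext i; cases i <;> rfl
/-- Writing `w3`. [folklore] -/
theorem upd_w3 : Function.update s.regs .w3 v = { s with w3 := v }.regs := by
  funext i; cases i <;> rfl
/-- Writing `f1`. [folklore] -/
theorem upd_f1 : Function.update s.regs .f1 v = { s with f1 := v }.regs := by
  funext i; cases i <;> rfl
/-- Writing `f2`. [folklore] -/
theorem upd_f2 : Function.update s.regs .f2 v = { s with f2 := v }.regs := by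
  funext i; cases i <;> rfl
/-- Writing `d1`. [folklore] -/
theorem upd_d1 : Function.update s.regs .d1 v = { s with d1 := v }.regs := by
  funext i; cases i <;> rfl
/-- Writing `d2`. [folklore] -/
theorem upd_d2 : Function.update s.regs .d2 v = { s with d2 := v }.regs := by
  funext i; cases i <;> rfl
/-- Writing `nb`. [folklore] -/
theorem upd_nb : Function.update s.regs .nb v = { s with nb := v }.regs := by
  funext i; cases i <;> rfl
/-- Writing `o`. [folklore] -/
theorem upd_o : Function.update s.regs .o v = { s with o := v }.regs := by
  funext i; cases i <;> rfl
/-- Writing `ku`. [folklore] -/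
theorem upd_ku : Function.update s.regs .ku v = { s with ku := v }.regs := by
  funext i; cases i <;> rfl
/-- Writing `hu`. [folklore] -/
theorem upd_hu : Function.update s.regs .hu v = { s with hu := v }.regs := by
  funext i; cases i <;> rfl
/-- Writing `fo`. [folklore] -/
theorem upd_fo : Function.update s.regs .fo v = { s with fo := v }.regs := by
  funext i; cases i <;> rfl
/-- Writing `k`. [folklore] -/
theorem upd_k : Function.update s.regs .k v = { s with k := v }.regs := by
  funext i; cases i <;> rfl
/-- Writing `ac`. [folklore] -/
theorem upd_ac : Function.update s.regs .ac v = { s with ac := v }.regs := by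
  funext i; cases i <;> rfl
/-- Writing `p0`. [folklore] -/
theorem upd_p0 : Function.update s.regs .p0 v = { s with p0 := v }.regs := by
  funext i; cases i <;> rfl
/-- Writing `p1`. [folklore] -/
theorem upd_p1 : Function.update s.regs .p1 v = { s with p1 := v }.regs := by
  funext i; cases i <;> rfl
/-- Writing `t`. [folklore] -/
theorem upd_t : Function.update s.regs .t v = { s with t := v }.regs := by
  funext i; cases i <;> rfl
/-- Writing `t2`. [folklore] -/
theorem upd_t2 : Function.update s.regs .t2 v = { s with t2 := v }.regs := by
  funext i; cases i <;> rfl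
/-- Writing `c`. [folklore] -/
theorem upd_c : Function.update s.regs .c v = { s with c := v }.regs := by
  funext i; cases i <;> rfl
/-- Writing `res`. [folklore] -/
theorem upd_res : Function.update s.regs .res v = { s with res := v }.regs := by
  funext i; cases i <;> rfl

end Lemmas

/-- The initial state: everything empty but the input. [folklore] -/
def init (z : List Bool) : St where
  inp := z
  u := []
  u2 := []
  uc := []
  g := []
  wa := []
  w1 := []
  w2 := []
  w3 := []
  f1 := []
  f2 := []
  d1 := []
  d2 := []
  nb := []
  o := []
  ku := []
  hu := []
  fo := []
  k := []
  ac := []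
  p0 := []
  p1 := []
  t := []
  t2 := []
  c := []
  res := []

/-- The initial register file is the initial state. [folklore] -/
theorem regs_init (z : List Bool) : Regs.init R.inp z = (init z).regs := by
  funext i; cases i <;> rfl

end St
/-- Flags are `[]` or `[true]`. [folklore] -/
def IsFlag (l : List Bool) : Prop := ∃ b, l = flag b

/-- The empty register is a flag. [folklore] -/
theorem isFlag_nil : IsFlag [] := ⟨false, rfl⟩
/-- `[true]` is a flag. [folklore] -/
theorem isFlag_true : IsFlag [true] := ⟨true, rfl⟩
/-- `flag b` is a flag. [folklore] -/
theorem isFlag_flag (b : Bool) : IsFlag (flag b) := ⟨b, rfl⟩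
/-- A flag has length at most one. [folklore] -/
theorem IsFlag.length_le {l : List Bool} (h : IsFlag l) : l.length ≤ 1 := by
  obtain ⟨b, rfl⟩ := h; cases b <;> simp

/-! ### The printing macros -/

/-- Print the element of the constant shape. [cite: AaronsonAmbainis2018, §6 Thm. 25 (proof)] -/
def emitNone : Com R := pushList .o codeNoneL

/-- Print the element of the projection shape on the wire whose numeral is in `src`.
[cite: AaronsonAmbainis2018, §6 Thm. 25 (proof)] -/
def emitOne (src : R) : Com R :=
  pushList .o (List.replicate 2 false ++ List.replicate 2 true ++ List.replicate 2 false) ;;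
    emitRep src .t .o 2 ;; pushList .o [false, true]

/-- Print the element of the two-bit shape on the wires whose numerals are in `s1`, `s2`.
[cite: AaronsonAmbainis2018, §6 Thm. 25 (proof)] -/
def emitTwo (s1 s2 : R) : Com R :=
  pushList .o pre2 ;; emitRep s1 .t .o 16 ;; pushList .o mid2 ;; emitRep s2 .t .o 16 ;; pushList .o post2

/-- Print the element of the three-bit shape on the wires in `s1`, `s2`, `s3` (numerals printed
in the order `s2`, `s3`, `s1`). [cite: AaronsonAmbainis2018, §6 Thm. 25 (proof)] -/
def emitThree (s1 s2 s3 : R) : Com R :=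
  pushList .o pre2 ;; emitRep s2 .t .o 16 ;; pushList .o mid2 ;; emitRep s3 .t .o 16 ;; pushList .o mid3 ;;
    emitRep s1 .t .o 16 ;; pushList .o post3

/-- The CSIGN gadget on two wires: three copies of the two-bit shape. [cite: AaronsonAmbainis2018, §6 Thm. 25 (the gadget)] -/
def gadget (s1 s2 : R) : Com R := emitTwo s1 s2 ;; emitTwo s1 s2 ;; emitTwo s1 s2

/-- The triple of gadgets simulating a Hadamard gate on the wire in `a` with the dummies, each
gadget followed by a separator (`tripleS a d₁ d₂ ++ [1]`). [cite: AaronsonAmbainis2018, §6 Thm. 25 (proof)] -/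
def triple (a : R) : Com R :=
  gadget a .d1 ;; emitNone ;; gadget .d1 .d2 ;; emitNone ;; gadget a .d2 ;; emitNone

/-- Pour the accumulated numeral into the next free wire slot. [folklore] -/
def commit : Com R :=
  ifFlag .f1 (ifFlag .f2 (Com.pour .wa .w3) (Com.pour .wa .w2 ;; Com.push .f2 true))
    (Com.pour .wa .w1 ;; Com.push .f1 true)

/-- Clear the accumulator, the wire slots and their flags. [folklore] -/
def cleanup : Com R :=
  Com.clear .wa ;; Com.clear .w1 ;; Com.clear .w2 ;; Com.clear .w3 ;; clearFlag .f1 ;; clearFlag .f2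

/-- Handler of a Hadamard gate. [cite: AaronsonAmbainis2018, §6 Thm. 25 (proof)] -/
def hKH : Com R := triple .w1 ;; pushList .ku (List.replicate 12 true) ;; Com.push .hu true ;; cleanup
/-- Handler of a `Z` gate. [cite: AaronsonAmbainis2018, §6 Thm. 25 (proof)] -/
def hKZ : Com R := emitNone ;; emitOne .w1 ;; emitNone ;; emitNone ;; pushList .ku (List.replicate 4 true) ;; cleanup
/-- Handler of a `CZ` gate. [cite: AaronsonAmbainis2018, §6 Thm. 25 (proof)] -/
def hKCZ : Com R := emitNone ;; emitTwo .w1 .w2 ;; emitNone ;; emitNone ;; pushList .ku (List.replicate 4 true) ;; cleanup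
/-- Handler of a `CCZ` gate. [cite: AaronsonAmbainis2018, §6 Thm. 25 (proof)] -/
def hKCCZ : Com R :=
  emitNone ;; emitThree .w1 .w2 .w3 ;; emitNone ;; emitNone ;; pushList .ku (List.replicate 4 true) ;; cleanup
/-- Handler of an oracle gate (outside the promise): the identity block, and the flag.
[cite: AaronsonAmbainis2018, §6 Thm. 25 (proof)] -/
def hKOR : Com R := setFlag .fo ;; emitNone ;; emitNone ;; pushList .ku [true, true] ;; cleanup

/-- The handler of the token `a b d`. [folklore] -/
def handler : Bool → Bool → Bool → Com R
  | false, false, d => Com.push .wa d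
  | false, true, false => commit
  | false, true, true => hKOR
  | true, false, false => hKH
  | true, false, true => hKZ
  | true, true, false => hKCZ
  | true, true, true => hKCCZ

/-- Dispatch on the third bit. [folklore] -/
def disp2 (a b : Bool) : Com R := Com.pop .g (handler a b true) (handler a b false) Com.skip
/-- Dispatch on the second bit. [folklore] -/
def disp1 (a : Bool) : Com R := Com.pop .g (disp2 a true) (disp2 a false) Com.skip
/-- **The gate loop**: dispatch on the first bit of each token until the stream `g` is exhausted.
[cite: AaronsonAmbainis2018, §6 Thm. 25 (proof)] -/
def gateLoop : Com R := Com.loop .g (disp1 true) (disp1 false)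

/-! ### Functional models -/

/-- The printed block of a Hadamard gate on the wire with numeral `u` (dummies `d₁`, `d₂`).
[cite: AaronsonAmbainis2018, §6 Thm. 25 (proof)] -/
def blockH (u d₁ d₂ : List Bool) : List Bool :=
  (codeTwoL u d₁ ++ codeTwoL u d₁ ++ codeTwoL u d₁ ++ codeNoneL) ++
    ((codeTwoL d₁ d₂ ++ codeTwoL d₁ d₂ ++ codeTwoL d₁ d₂ ++ codeNoneL) ++
      (codeTwoL u d₂ ++ codeTwoL u d₂ ++ codeTwoL u d₂ ++ codeNoneL))
/-- The printed block of a `Z` gate. [cite: AaronsonAmbainis2018, §6 Thm. 25 (proof)] -/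
def blockZ (u : List Bool) : List Bool := codeNoneL ++ codeOneL u ++ codeNoneL ++ codeNoneL
/-- The printed block of a `CZ` gate. [cite: AaronsonAmbainis2018, §6 Thm. 25 (proof)] -/
def blockCZ (u v : List Bool) : List Bool := codeNoneL ++ codeTwoL u v ++ codeNoneL ++ codeNoneL
/-- The printed block of a `CCZ` gate. [cite: AaronsonAmbainis2018, §6 Thm. 25 (proof)] -/
def blockCCZ (u v w : List Bool) : List Bool := codeNoneL ++ codeThreeL u v w ++ codeNoneL ++ codeNoneL
/-- The printed block of an oracle gate. [cite: AaronsonAmbainis2018, §6 Thm. 25 (proof)] -/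
def blockOR : List Bool := codeNoneL ++ codeNoneL

/-- Model of `cleanup`. [folklore] -/
def cleanupM (s : St) : St := { s with wa := [], w1 := [], w2 := [], w3 := [], f1 := [], f2 := [] }

/-- Model of `commit`. [folklore] -/
def commitM (s : St) : St :=
  if s.f1 = [] then { s with wa := [], w1 := s.wa.reverse ++ s.w1, f1 := [true] }
  else if s.f2 = [] then { s with wa := [], w2 := s.wa.reverse ++ s.w2, f2 := [true] }
  else { s with wa := [], w3 := s.wa.reverse ++ s.w3 }

/-- Model of `hKH`. [folklore] -/
def hKHM (s : St) : St :=
  cleanupM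
    { s with
      o := (blockH s.w1 s.d1 s.d2).reverse ++ s.o
      ku := List.replicate 12 true ++ s.ku
      hu := true :: s.hu }
/-- Model of `hKZ`. [folklore] -/
def hKZM (s : St) : St :=
  cleanupM { s with o := (blockZ s.w1).reverse ++ s.o, ku := List.replicate 4 true ++ s.ku }
/-- Model of `hKCZ`. [folklore] -/
def hKCZM (s : St) : St :=
  cleanupM { s with o := (blockCZ s.w1 s.w2).reverse ++ s.o, ku := List.replicate 4 true ++ s.ku }
/-- Model of `hKCCZ`. [folklore] -/
def hKCCZM (s : St) : St :=
  cleanupM { s with o := (blockCCZ s.w1 s.w2 s.w3).reverse ++ s.o, ku := List.replicate 4 true ++ s.ku }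
/-- Model of `hKOR`. [folklore] -/
def hKORM (s : St) : St :=
  cleanupM { s with o := blockOR.reverse ++ s.o, ku := [true, true] ++ s.ku, fo := [true] }

/-- Model of the handlers. [folklore] -/
def actM : Bool → Bool → Bool → St → St
  | false, false, d, s => { s with wa := d :: s.wa }
  | false, true, false, s => commitM s
  | false, true, true, s => hKORM s
  | true, false, false, s => hKHM s
  | true, false, true, s => hKZM s
  | true, true, false, s => hKCZM s
  | true, true, true, s => hKCCZM s

/-- **Model of the gate loop** on an arbitrary bit stream: tokens of three bits are handled in
turn; a remainder of fewer than three bits is discarded. [folklore] -/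
def loopM : List Bool → St → St
  | a :: b :: d :: z, s => loopM z (actM a b d { s with g := z })
  | _, s => { s with g := [] }

/-- `loopM` on the empty stream. [folklore] -/
theorem loopM_nil (s : St) : loopM [] s = { s with g := [] } := rfl
/-- `loopM` on one leftover bit. [folklore] -/
theorem loopM_one (a : Bool) (s : St) : loopM [a] s = { s with g := [] } := rfl
/-- `loopM` on two leftover bits. [folklore] -/
theorem loopM_two (a b : Bool) (s : St) : loopM [a, b] s = { s with g := [] } := rfl
/-- `loopM` on a full token. [folklore] -/
theorem loopM_cons₃ (a b d : Bool) (z : List Bool) (s : St) :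
    loopM (a :: b :: d :: z) s = loopM z (actM a b d { s with g := z }) := rfl

/-- The invariant of the gate loop (with the size bound `L`): scratch empty, flags are flags,
accumulator + slots + remaining stream within `L`, dummies within `L`. [folklore] -/
structure Inv (L : ℕ) (s : St) : Prop where
  /-- scratch register empty -/
  ht : s.t = []
  /-- first slot flag -/
  hf1 : IsFlag s.f1
  /-- second slot flag -/
  hf2 : IsFlag s.f2
  /-- oracle flag -/
  hfo : IsFlag s.fo
  /-- size of accumulator, slots and stream -/
  hsz : s.wa.length + s.w1.length + s.w2.length + s.w3.length + s.g.length ≤ L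
  /-- size of the first dummy numeral -/
  hd1 : s.d1.length ≤ L
  /-- size of the second dummy numeral -/
  hd2 : s.d2.length ≤ L

/-- Changing the body register does not change the others. [folklore] -/
theorem St.regs_o_update (s : St) (x : List Bool) {r : R} (hr : r ≠ R.o) :
    ({ s with o := x } : St).regs r = s.regs r := by
  cases r <;> first | rfl | exact absurd rfl hr

/-! ### The macros run -/

/-- `emitNone` prints `codeNoneL`. [folklore] -/
theorem runs_emitNone (s : St) : Runs emitNone s.regs { s with o := codeNoneL.reverse ++ s.o }.regs 48 := by
  have e := runs_pushList R.o codeNoneL s.regs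
  rw [length_codeNoneL, St.upd_o] at e
  exact e

/-- `emitOne` prints `codeOneL`. [folklore] -/
theorem runs_emitOne {src : R} (h1o : src ≠ .o) (h1t : src ≠ .t) (s : St) {u : List Bool}
    (hu : s.regs src = u) (ht : s.t = []) :
    Runs (emitOne src) s.regs { s with o := (codeOneL u).reverse ++ s.o }.regs (8 * u.length + 10) := by
  have hto : R.t ≠ R.o := by decide
  have e1 := runs_pushList R.o (List.replicate 2 false ++ List.replicate 2 true ++ List.replicate 2 false) s.regs
  set R1 := Function.update s.regs R.o
    ((List.replicate 2 false ++ List.replicate 2 true ++ List.replicate 2 false).reverse ++ s.regs R.o) with hR1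
  have e2 := runs_emitRep h1o h1t hto 2 R1 (by simp [hR1, ht])
  have hR1s : R1 src = u := by simp [hR1, h1o, hu]
  rw [hR1s] at e2
  set R2 := Function.update R1 R.o ((rep 2 u).reverse ++ R1 R.o) with hR2
  have e3 := runs_pushList R.o [false, true] R2
  refine (e1.seq (e2.seq e3)).of_eq ?_ ?_
  · simp only [hR2, hR1, codeOneL, St.regs_o, List.reverse_append, List.reverse_cons, List.reverse_nil,
      List.reverse_replicate, List.append_assoc, List.nil_append, List.cons_append, St.upd_o]
  · simp; omega

/-- `emitTwo` prints `codeTwoL`. [folklore] -/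
theorem runs_emitTwo {s1 s2 : R} (h1o : s1 ≠ .o) (h1t : s1 ≠ .t) (h2o : s2 ≠ .o) (h2t : s2 ≠ .t) (s : St)
    {u v : List Bool} (hu : s.regs s1 = u) (hv : s.regs s2 = v) (ht : s.t = []) :
    Runs (emitTwo s1 s2) s.regs { s with o := (codeTwoL u v).reverse ++ s.o }.regs
      (22 * u.length + 22 * v.length + 164) := by
  have hto : R.t ≠ R.o := by decide
  have e1 := runs_pushList R.o pre2 s.regs
  set R1 := Function.update s.regs R.o (pre2.reverse ++ s.regs R.o) with hR1
  have e2 := runs_emitRep h1o h1t hto 16 R1 (by simp [hR1, ht])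
  have hR1s : R1 s1 = u := by simp [hR1, h1o, hu]
  rw [hR1s] at e2
  set R2 := Function.update R1 R.o ((rep 16 u).reverse ++ R1 R.o) with hR2
  have e3 := runs_pushList R.o mid2 R2
  set R3 := Function.update R2 R.o (mid2.reverse ++ R2 R.o) with hR3
  have e4 := runs_emitRep h2o h2t hto 16 R3 (by simp [hR3, hR2, hR1, ht])
  have hR3s : R3 s2 = v := by simp [hR3, hR2, hR1, h2o, hv]
  rw [hR3s] at e4
  set R4 := Function.update R3 R.o ((rep 16 v).reverse ++ R3 R.o) with hR4
  have e5 := runs_pushList R.o post2 R4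
  refine (e1.seq (e2.seq (e3.seq (e4.seq e5)))).of_eq ?_ ?_
  · simp only [hR4, hR3, hR2, hR1, codeTwoL, pre2, mid2, post2, St.regs_o, List.reverse_append, List.reverse_cons, List.reverse_nil,
      List.reverse_replicate, List.append_assoc, List.nil_append, List.cons_append, St.upd_o]
  · simp [pre2, mid2, post2]; omega

/-- `emitThree` prints `codeThreeL`. [folklore] -/
theorem runs_emitThree {s1 s2 s3 : R} (h1o : s1 ≠ .o) (h1t : s1 ≠ .t) (h2o : s2 ≠ .o) (h2t : s2 ≠ .t)
    (h3o : s3 ≠ .o) (h3t : s3 ≠ .t) (s : St) {u v w : List Bool} (hu : s.regs s1 = u) (hv : s.regs s2 = v)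
    (hw : s.regs s3 = w) (ht : s.t = []) :
    Runs (emitThree s1 s2 s3) s.regs { s with o := (codeThreeL u v w).reverse ++ s.o }.regs
      (22 * u.length + 22 * v.length + 22 * w.length + 320) := by
  have hto : R.t ≠ R.o := by decide
  have e1 := runs_pushList R.o pre2 s.regs
  set R1 := Function.update s.regs R.o (pre2.reverse ++ s.regs R.o) with hR1
  have e2 := runs_emitRep h2o h2t hto 16 R1 (by simp [hR1, ht])
  have hR1s : R1 s2 = v := by simp [hR1, h2o, hv]
  rw [hR1s] at e2
  set R2 := Function.update R1 R.o ((rep 16 v).reverse ++ R1 R.o) with hR2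
  have e3 := runs_pushList R.o mid2 R2
  set R3 := Function.update R2 R.o (mid2.reverse ++ R2 R.o) with hR3
  have e4 := runs_emitRep h3o h3t hto 16 R3 (by simp [hR3, hR2, hR1, ht])
  have hR3s : R3 s3 = w := by simp [hR3, hR2, hR1, h3o, hw]
  rw [hR3s] at e4
  set R4 := Function.update R3 R.o ((rep 16 w).reverse ++ R3 R.o) with hR4
  have e5 := runs_pushList R.o mid3 R4
  set R5 := Function.update R4 R.o (mid3.reverse ++ R4 R.o) with hR5
  have e6 := runs_emitRep h1o h1t hto 16 R5 (by simp [hR5, hR4, hR3, hR2, hR1, ht])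
  have hR5s : R5 s1 = u := by simp [hR5, hR4, hR3, hR2, hR1, h1o, hu]
  rw [hR5s] at e6
  set R6 := Function.update R5 R.o ((rep 16 u).reverse ++ R5 R.o) with hR6
  have e7 := runs_pushList R.o post3 R6
  refine (e1.seq (e2.seq (e3.seq (e4.seq (e5.seq (e6.seq e7)))))).of_eq ?_ ?_
  · simp only [hR6, hR5, hR4, hR3, hR2, hR1, codeThreeL, pre2, mid2, mid3, post3, St.regs_o, List.reverse_append, List.reverse_cons, List.reverse_nil,
      List.reverse_replicate, List.append_assoc, List.nil_append, List.cons_append, St.upd_o]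
  · simp [pre2, mid2, mid3, post3]; omega

/-- `gadget` prints three copies of `codeTwoL`. [folklore] -/
theorem runs_gadget {s1 s2 : R} (h1o : s1 ≠ .o) (h1t : s1 ≠ .t) (h2o : s2 ≠ .o) (h2t : s2 ≠ .t) (s : St)
    {u v : List Bool} (hu : s.regs s1 = u) (hv : s.regs s2 = v) (ht : s.t = []) :
    Runs (gadget s1 s2) s.regs
      { s with o := (codeTwoL u v ++ codeTwoL u v ++ codeTwoL u v).reverse ++ s.o }.regs
      (3 * (22 * u.length + 22 * v.length + 164)) := by
  have e1 := runs_emitTwo h1o h1t h2o h2t s hu hv ht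
  have e2 := runs_emitTwo h1o h1t h2o h2t { s with o := (codeTwoL u v).reverse ++ s.o }
    (by rw [St.regs_o_update _ _ h1o, hu]) (by rw [St.regs_o_update _ _ h2o, hv]) ht
  have e3 := runs_emitTwo h1o h1t h2o h2t { s with o := (codeTwoL u v).reverse ++ ((codeTwoL u v).reverse ++ s.o) }
    (by rw [St.regs_o_update _ _ h1o, hu]) (by rw [St.regs_o_update _ _ h2o, hv]) ht
  refine (e1.seq (e2.seq e3)).of_eq ?_ (by omega)
  simp only [List.reverse_append, List.append_assoc]

/-- `triple` prints the block of the triple of gadgets with their separators. [folklore] -/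
theorem runs_triple {a : R} (hao : a ≠ .o) (hat : a ≠ .t) (s : St) {u : List Bool} (hu : s.regs a = u)
    (ht : s.t = []) :
    Runs (triple a) s.regs { s with o := (blockH u s.d1 s.d2).reverse ++ s.o }.regs
      (132 * u.length + 132 * s.d1.length + 132 * s.d2.length + 1620) := by
  have hd1o : R.d1 ≠ .o := by decide
  have hd1t : R.d1 ≠ .t := by decide
  have hd2o : R.d2 ≠ .o := by decide
  have hd2t : R.d2 ≠ .t := by decide
  have e1 := runs_gadget hao hat hd1o hd1t s hu (St.regs_d1 s) ht
  have e2 := runs_emitNone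
    { s with o := (codeTwoL u s.d1 ++ codeTwoL u s.d1 ++ codeTwoL u s.d1).reverse ++ s.o }
  set o2 := codeNoneL.reverse ++ ((codeTwoL u s.d1 ++ codeTwoL u s.d1 ++ codeTwoL u s.d1).reverse ++ s.o) with ho2
  have e3 := runs_gadget hd1o hd1t hd2o hd2t { s with o := o2 } (show St.regs { s with o := o2 } R.d1 = s.d1 from rfl)
    (show St.regs { s with o := o2 } R.d2 = s.d2 from rfl) ht
  set o3 := (codeTwoL s.d1 s.d2 ++ codeTwoL s.d1 s.d2 ++ codeTwoL s.d1 s.d2).reverse ++ o2 with ho3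
  have e4 := runs_emitNone { s with o := o3 }
  set o4 := codeNoneL.reverse ++ o3 with ho4
  have e5 := runs_gadget hao hat hd2o hd2t { s with o := o4 } (by rw [St.regs_o_update _ _ hao, hu])
    (show St.regs { s with o := o4 } R.d2 = s.d2 from rfl) ht
  set o5 := (codeTwoL u s.d2 ++ codeTwoL u s.d2 ++ codeTwoL u s.d2).reverse ++ o4 with ho5
  have e6 := runs_emitNone { s with o := o5 }
  refine (e1.seq (e2.seq (e3.seq (e4.seq (e5.seq e6))))).of_eq ?_ (by omega)
  simp only [ho5, ho4, ho3, ho2, blockH, List.reverse_append, List.append_assoc]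

/-- `cleanup` empties the accumulator, the slots and their flags. [folklore] -/
theorem runs_cleanup (s : St) (h1 : IsFlag s.f1) (h2 : IsFlag s.f2) :
    Runs cleanup s.regs (cleanupM s).regs (2 * (s.wa.length + s.w1.length + s.w2.length + s.w3.length) + 8) := by
  obtain ⟨b1, hb1⟩ := h1
  obtain ⟨b2, hb2⟩ := h2
  have e1 := runs_clear R.wa s.regs
  rw [St.upd_wa, St.regs_wa] at e1
  have e2 := runs_clear R.w1 { s with wa := [] }.regs
  rw [St.upd_w1, St.regs_w1] at e2
  have e3 := runs_clear R.w2 { s with wa := [], w1 := [] }.regs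
  rw [St.upd_w2, St.regs_w2] at e3
  have e4 := runs_clear R.w3 { s with wa := [], w1 := [], w2 := [] }.regs
  rw [St.upd_w3, St.regs_w3] at e4
  have e5 := runs_clearFlag R.f1 { s with wa := [], w1 := [], w2 := [], w3 := [] }.regs b1 hb1
  rw [St.upd_f1] at e5
  have e6 := runs_clearFlag R.f2 { s with wa := [], w1 := [], w2 := [], w3 := [], f1 := [] }.regs b2 hb2
  rw [St.upd_f2] at e6
  exact (e1.seq (e2.seq (e3.seq (e4.seq (e5.seq e6))))).of_eq rfl (by simp; omega)

/-- `commit` pours the accumulator into the next free slot. [folklore] -/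
theorem runs_commit (s : St) (h1 : IsFlag s.f1) (h2 : IsFlag s.f2) :
    Runs commit s.regs (commitM s).regs (3 * s.wa.length + 8) := by
  obtain ⟨b1, hb1⟩ := h1
  obtain ⟨b2, hb2⟩ := h2
  unfold commit commitM
  cases b1
  · -- first slot free
    have hf : s.f1 = [] := hb1
    rw [if_pos hf]
    have e1 := runs_pour (a := R.wa) (b := R.w1) (by decide) s.regs
    rw [St.regs_wa, St.regs_w1, St.upd_wa, St.upd_w1] at e1
    have e2 : Runs (Com.push R.f1 true) { s with wa := [], w1 := s.wa.reverse ++ s.w1 }.regs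
        { s with wa := [], w1 := s.wa.reverse ++ s.w1, f1 := [true] }.regs 1 :=
      Runs.push' (by rw [St.upd_f1]; simp [hf])
    exact (runs_ifFlag_false _ (by simpa using hb1) (e1.seq e2)).of_eq rfl (by omega)
  · have hf : s.f1 ≠ [] := by rw [hb1]; simp
    rw [if_neg hf]
    cases b2
    · have hf2 : s.f2 = [] := hb2
      rw [if_pos hf2]
      have e1 := runs_pour (a := R.wa) (b := R.w2) (by decide) s.regs
      rw [St.regs_wa, St.regs_w2, St.upd_wa, St.upd_w2] at e1
      have e2 : Runs (Com.push R.f2 true) { s with wa := [], w2 := s.wa.reverse ++ s.w2 }.regs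
          { s with wa := [], w2 := s.wa.reverse ++ s.w2, f2 := [true] }.regs 1 :=
        Runs.push' (by rw [St.upd_f2]; simp [hf2])
      exact (runs_ifFlag_true _ (by simpa using hb1)
        (runs_ifFlag_false _ (by simpa using hb2) (e1.seq e2))).of_eq rfl (by omega)
    · have hf2 : s.f2 ≠ [] := by rw [hb2]; simp
      rw [if_neg hf2]
      have e1 := runs_pour (a := R.wa) (b := R.w3) (by decide) s.regs
      rw [St.regs_wa, St.regs_w3, St.upd_wa, St.upd_w3] at e1
      exact (runs_ifFlag_true _ (by simpa using hb1)
        (runs_ifFlag_true _ (by simpa using hb2) e1)).of_eq rfl (by omega)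

/-! ### The handlers run -/

/-- Handler of `H`. [folklore] -/
theorem runs_hKH (s : St) (ht : s.t = []) (h1 : IsFlag s.f1) (h2 : IsFlag s.f2) :
    Runs hKH s.regs (hKHM s).regs
      (132 * s.w1.length + 132 * s.d1.length + 132 * s.d2.length + 1633 +
        (2 * (s.wa.length + s.w1.length + s.w2.length + s.w3.length) + 8)) := by
  have e1 := runs_triple (a := R.w1) (by decide) (by decide) s (St.regs_w1 s) ht
  set s1 : St := { s with o := (blockH s.w1 s.d1 s.d2).reverse ++ s.o } with hs1
  have e2 := runs_pushList R.ku (List.replicate 12 true) s1.regs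
  rw [St.upd_ku, St.regs_ku, List.reverse_replicate, List.length_replicate] at e2
  set s2 : St := { s1 with ku := List.replicate 12 true ++ s1.ku } with hs2
  have e3 : Runs (Com.push R.hu true) s2.regs { s2 with hu := true :: s2.hu }.regs 1 := Runs.push' (St.upd_hu _ _)
  have e4 := runs_cleanup { s2 with hu := true :: s2.hu } h1 h2
  exact (e1.seq (e2.seq (e3.seq e4))).of_eq rfl (by simp only [hs2, hs1]; omega)

/-- Handler of `Z`. [folklore] -/
theorem runs_hKZ (s : St) (ht : s.t = []) (h1 : IsFlag s.f1) (h2 : IsFlag s.f2) :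
    Runs hKZ s.regs (hKZM s).regs
      (8 * s.w1.length + 158 + (2 * (s.wa.length + s.w1.length + s.w2.length + s.w3.length) + 8)) := by
  have e1 := runs_emitNone s
  set s1 : St := { s with o := codeNoneL.reverse ++ s.o } with hs1
  have e2 := runs_emitOne (src := R.w1) (by decide) (by decide) s1 (show s1.regs R.w1 = s.w1 from rfl) ht
  set s2 : St := { s1 with o := (codeOneL s.w1).reverse ++ s1.o } with hs2
  have e3 := runs_emitNone s2
  set s3 : St := { s2 with o := codeNoneL.reverse ++ s2.o } with hs3
  have e4 := runs_emitNone s3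
  set s4 : St := { s3 with o := codeNoneL.reverse ++ s3.o } with hs4
  have e5 := runs_pushList R.ku (List.replicate 4 true) s4.regs
  rw [St.upd_ku, St.regs_ku, List.reverse_replicate, List.length_replicate] at e5
  have e6 := runs_cleanup { s4 with ku := List.replicate 4 true ++ s4.ku } h1 h2
  refine (e1.seq (e2.seq (e3.seq (e4.seq (e5.seq e6))))).of_eq ?_ (by simp only [hs4, hs3, hs2, hs1]; omega)
  simp only [hs4, hs3, hs2, hs1, hKZM, blockZ, List.reverse_append, List.append_assoc]

/-- Handler of `CZ`. [folklore] -/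
theorem runs_hKCZ (s : St) (ht : s.t = []) (h1 : IsFlag s.f1) (h2 : IsFlag s.f2) :
    Runs hKCZ s.regs (hKCZM s).regs
      (22 * s.w1.length + 22 * s.w2.length + 312 +
        (2 * (s.wa.length + s.w1.length + s.w2.length + s.w3.length) + 8)) := by
  have e1 := runs_emitNone s
  set s1 : St := { s with o := codeNoneL.reverse ++ s.o } with hs1
  have e2 := runs_emitTwo (s1 := R.w1) (s2 := R.w2) (by decide) (by decide) (by decide) (by decide) s1
    (show s1.regs R.w1 = s.w1 from rfl) (show s1.regs R.w2 = s.w2 from rfl) ht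
  set s2 : St := { s1 with o := (codeTwoL s.w1 s.w2).reverse ++ s1.o } with hs2
  have e3 := runs_emitNone s2
  set s3 : St := { s2 with o := codeNoneL.reverse ++ s2.o } with hs3
  have e4 := runs_emitNone s3
  set s4 : St := { s3 with o := codeNoneL.reverse ++ s3.o } with hs4
  have e5 := runs_pushList R.ku (List.replicate 4 true) s4.regs
  rw [St.upd_ku, St.regs_ku, List.reverse_replicate, List.length_replicate] at e5
  have e6 := runs_cleanup { s4 with ku := List.replicate 4 true ++ s4.ku } h1 h2
  refine (e1.seq (e2.seq (e3.seq (e4.seq (e5.seq e6))))).of_eq ?_ (by simp only [hs4, hs3, hs2, hs1]; omega)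
  simp only [hs4, hs3, hs2, hs1, hKCZM, blockCZ, List.reverse_append, List.append_assoc]

/-- Handler of `CCZ`. [folklore] -/
theorem runs_hKCCZ (s : St) (ht : s.t = []) (h1 : IsFlag s.f1) (h2 : IsFlag s.f2) :
    Runs hKCCZ s.regs (hKCCZM s).regs
      (22 * s.w1.length + 22 * s.w2.length + 22 * s.w3.length + 468 +
        (2 * (s.wa.length + s.w1.length + s.w2.length + s.w3.length) + 8)) := by
  have e1 := runs_emitNone s
  set s1 : St := { s with o := codeNoneL.reverse ++ s.o } with hs1
  have e2 := runs_emitThree (s1 := R.w1) (s2 := R.w2) (s3 := R.w3) (by decide) (by decide) (by decide) (by decide)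
    (by decide) (by decide) s1 (show s1.regs R.w1 = s.w1 from rfl) (show s1.regs R.w2 = s.w2 from rfl)
    (show s1.regs R.w3 = s.w3 from rfl) ht
  set s2 : St := { s1 with o := (codeThreeL s.w1 s.w2 s.w3).reverse ++ s1.o } with hs2
  have e3 := runs_emitNone s2
  set s3 : St := { s2 with o := codeNoneL.reverse ++ s2.o } with hs3
  have e4 := runs_emitNone s3
  set s4 : St := { s3 with o := codeNoneL.reverse ++ s3.o } with hs4
  have e5 := runs_pushList R.ku (List.replicate 4 true) s4.regs
  rw [St.upd_ku, St.regs_ku, List.reverse_replicate, List.length_replicate] at e5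
  have e6 := runs_cleanup { s4 with ku := List.replicate 4 true ++ s4.ku } h1 h2
  refine (e1.seq (e2.seq (e3.seq (e4.seq (e5.seq e6))))).of_eq ?_ (by simp only [hs4, hs3, hs2, hs1]; omega)
  simp only [hs4, hs3, hs2, hs1, hKCCZM, blockCCZ, List.reverse_append, List.append_assoc]

/-- Handler of an oracle gate. [folklore] -/
theorem runs_hKOR (s : St) (h1 : IsFlag s.f1) (h2 : IsFlag s.f2) (ho : IsFlag s.fo) :
    Runs hKOR s.regs (hKORM s).regs
      (101 + (2 * (s.wa.length + s.w1.length + s.w2.length + s.w3.length) + 8)) := by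
  obtain ⟨bo, hbo⟩ := ho
  have e1 := runs_setFlag R.fo s.regs bo hbo
  rw [St.upd_fo] at e1
  set s1 : St := { s with fo := [true] } with hs1
  have e2 := runs_emitNone s1
  set s2 : St := { s1 with o := codeNoneL.reverse ++ s1.o } with hs2
  have e3 := runs_emitNone s2
  set s3 : St := { s2 with o := codeNoneL.reverse ++ s2.o } with hs3
  have e4 := runs_pushList R.ku [true, true] s3.regs
  rw [St.upd_ku, St.regs_ku] at e4
  have e5 := runs_cleanup { s3 with ku := [true, true].reverse ++ s3.ku } h1 h2
  refine (e1.seq (e2.seq (e3.seq (e4.seq e5)))).of_eq ?_ (by simp only [hs3, hs2, hs1, List.length_cons, List.length_nil]; omega)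
  simp only [hs3, hs2, hs1, hKORM, blockOR, List.reverse_append, List.append_assoc, List.reverse_cons, List.reverse_nil,
    List.nil_append, List.cons_append]

/-- `commit` does not touch the stream register. [folklore] -/
theorem commitM_g (s : St) : (commitM s).g = s.g := by
  unfold commitM; split_ifs <;> rfl

/-- The handlers do not touch the stream register. [folklore] -/
theorem actM_g (a b d : Bool) (s : St) : (actM a b d s).g = s.g := by
  cases a <;> cases b <;> cases d <;> first | rfl | exact commitM_g s

/-- **Every handler runs from any state satisfying the invariant to its model, within
`404 L + 1650` steps.** [folklore] -/
theorem runs_handler {L : ℕ} (a b d : Bool) (s : St) (hI : Inv L s) :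
    Runs (handler a b d) s.regs (actM a b d s).regs (404 * L + 1650) := by
  obtain ⟨ht, hf1, hf2, hfo, hsz, hd1, hd2⟩ := hI
  cases a <;> cases b <;> cases d
  · exact (Runs.push' (St.upd_wa s _)).of_eq rfl (by omega)
  · exact (Runs.push' (St.upd_wa s _)).of_eq rfl (by omega)
  · exact (runs_commit s hf1 hf2).of_eq rfl (by omega)
  · exact (runs_hKOR s hf1 hf2 hfo).of_eq rfl (by omega)
  · exact (runs_hKH s ht hf1 hf2).of_eq rfl (by omega)
  · exact (runs_hKZ s ht hf1 hf2).of_eq rfl (by omega)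
  · exact (runs_hKCZ s ht hf1 hf2).of_eq rfl (by omega)
  · exact (runs_hKCCZ s ht hf1 hf2).of_eq rfl (by omega)

/-- The invariant survives shortening the stream. [folklore] -/
theorem Inv.of_g {L : ℕ} {s : St} (hI : Inv L s) {z : List Bool} (hz : z.length ≤ s.g.length) :
    Inv L { s with g := z } := by
  obtain ⟨ht, hf1, hf2, hfo, hsz, hd1, hd2⟩ := hI
  exact ⟨ht, hf1, hf2, hfo, by simp only at hsz ⊢; omega, hd1, hd2⟩

/-- **The handlers preserve the invariant** (a token consumed three bits of the stream, a bit
token adds one bit to the accumulator). [folklore] -/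
theorem inv_actM {L : ℕ} (a b d : Bool) (s : St) (z : List Bool) (hI : Inv L s) (hg : s.g = a :: b :: d :: z) :
    Inv L (actM a b d { s with g := z }) := by
  obtain ⟨ht, hf1, hf2, hfo, hsz, hd1, hd2⟩ := hI
  rw [hg] at hsz
  simp only [List.length_cons] at hsz
  cases a <;> cases b <;> cases d
  · exact ⟨ht, hf1, hf2, hfo, by simp only [actM, List.length_cons]; omega, hd1, hd2⟩
  · exact ⟨ht, hf1, hf2, hfo, by simp only [actM, List.length_cons]; omega, hd1, hd2⟩
  · -- commit
    simp only [actM, commitM]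
    split_ifs
    · exact ⟨ht, isFlag_true, hf2, hfo, by simp only [List.length_nil, List.length_append, List.length_reverse]; omega,
        hd1, hd2⟩
    · exact ⟨ht, hf1, isFlag_true, hfo, by simp only [List.length_nil, List.length_append, List.length_reverse]; omega,
        hd1, hd2⟩
    · exact ⟨ht, hf1, hf2, hfo, by simp only [List.length_nil, List.length_append, List.length_reverse]; omega, hd1, hd2⟩
  · exact ⟨ht, isFlag_nil, isFlag_nil, isFlag_true, by simp only [actM, hKORM, cleanupM, List.length_nil]; omega, hd1, hd2⟩
  · exact ⟨ht, isFlag_nil, isFlag_nil, hfo, by simp only [actM, hKHM, cleanupM, List.length_nil]; omega, hd1, hd2⟩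
  · exact ⟨ht, isFlag_nil, isFlag_nil, hfo, by simp only [actM, hKZM, cleanupM, List.length_nil]; omega, hd1, hd2⟩
  · exact ⟨ht, isFlag_nil, isFlag_nil, hfo, by simp only [actM, hKCZM, cleanupM, List.length_nil]; omega, hd1, hd2⟩
  · exact ⟨ht, isFlag_nil, isFlag_nil, hfo, by simp only [actM, hKCCZM, cleanupM, List.length_nil]; omega, hd1, hd2⟩

/-! ### The gate loop runs -/

/-- A state whose stream register already holds `z` is its own update. [folklore] -/
theorem St.with_g_eq (s : St) {z : List Bool} (h : s.g = z) : ({ s with g := z } : St) = s := by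
  rw [← h]

/-- **The gate loop on an arbitrary stream**: from a state satisfying the invariant it runs to
the model `loopM`, in at most `|g| (404 L + 1656) + 7` steps. [folklore] -/
theorem runs_gateLoop (L : ℕ) : ∀ (z : List Bool) (s : St), Inv L s → s.g = z →
    Runs gateLoop s.regs (loopM z s).regs (z.length * (404 * L + 1656) + 7)
  | [], s, _, hg => by
    refine (Runs.loop_nil (disp1 true) (disp1 false) (show s.regs R.g = [] from hg)).of_eq ?_ (by simp)
    rw [loopM_nil, St.with_g_eq s hg]
  | [a], s, _, hg => by
    have h1 : Runs (disp1 a) { s with g := [] }.regs { s with g := [] }.regs 2 :=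
      (Runs.pop_nil _ _ rfl (Runs.skip _)).of_eq rfl (by omega)
    have h2 : Runs gateLoop { s with g := [] }.regs { s with g := [] }.regs 1 := Runs.loop_nil _ _ rfl
    have hk : s.regs R.g = a :: [] := hg
    cases a
    · exact (Runs.loop_false' hk (St.upd_g s _) h1 h2).of_eq (by rw [loopM_one]) (by simp)
    · exact (Runs.loop_true' hk (St.upd_g s _) h1 h2).of_eq (by rw [loopM_one]) (by simp)
  | [a, b], s, _, hg => by
    have h0 : ∀ c : Bool, Runs (disp2 a c) { s with g := [] }.regs { s with g := [] }.regs 2 := fun c =>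
      (Runs.pop_nil _ _ rfl (Runs.skip _)).of_eq rfl (by omega)
    have hk1 : ({ s with g := [b] } : St).regs R.g = b :: [] := rfl
    have h1 : Runs (disp1 a) { s with g := [b] }.regs { s with g := [] }.regs 4 := by
      cases b
      · exact (Runs.pop_false' _ _ hk1 (St.upd_g _ _) (h0 false)).of_eq rfl (by omega)
      · exact (Runs.pop_true' _ _ hk1 (St.upd_g _ _) (h0 true)).of_eq rfl (by omega)
    have h2 : Runs gateLoop { s with g := [] }.regs { s with g := [] }.regs 1 := Runs.loop_nil _ _ rfl
    have hk : s.regs R.g = a :: [b] := hg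
    cases a
    · exact (Runs.loop_false' hk (St.upd_g s _) h1 h2).of_eq (by rw [loopM_two]) (by simp)
    · exact (Runs.loop_true' hk (St.upd_g s _) h1 h2).of_eq (by rw [loopM_two]) (by simp)
  | a :: b :: d :: z, s, hI, hg => by
    have hI' : Inv L { s with g := z } := hI.of_g (by rw [hg]; simp only [List.length_cons]; omega)
    have hh := runs_handler a b d { s with g := z } hI'
    have hrec := runs_gateLoop L z (actM a b d { s with g := z }) (inv_actM a b d s z hI hg) (by rw [actM_g])
    have hk2 : ({ s with g := d :: z } : St).regs R.g = d :: z := rfl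
    have h2 : Runs (disp2 a b) { s with g := d :: z }.regs (actM a b d { s with g := z }).regs (404 * L + 1650 + 2) := by
      cases d
      · exact Runs.pop_false' _ _ hk2 (St.upd_g _ _) hh
      · exact Runs.pop_true' _ _ hk2 (St.upd_g _ _) hh
    have hk1 : ({ s with g := b :: d :: z } : St).regs R.g = b :: d :: z := rfl
    have h1 : Runs (disp1 a) { s with g := b :: d :: z }.regs (actM a b d { s with g := z }).regs
        (404 * L + 1650 + 2 + 2) := by
      cases b
      · exact Runs.pop_false' _ _ hk1 (St.upd_g _ _) h2
      · exact Runs.pop_true' _ _ hk1 (St.upd_g _ _) h2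
    have hk : s.regs R.g = a :: b :: d :: z := hg
    have hX : (a :: b :: d :: z).length * (404 * L + 1656) = z.length * (404 * L + 1656) + 3 * (404 * L + 1656) := by
      simp only [List.length_cons]; ring
    have hcost : 404 * L + 1650 + 2 + 2 + 2 + (z.length * (404 * L + 1656) + 7) ≤
        (a :: b :: d :: z).length * (404 * L + 1656) + 7 := by omega
    cases a
    · exact (Runs.loop_false' hk (St.upd_g s _) h1 hrec).of_eq (by rw [loopM_cons₃]) hcost
    · exact (Runs.loop_true' hk (St.upd_g s _) h1 hrec).of_eq (by rw [loopM_cons₃]) hcost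

end Thm25Asm

end Literature.Computability.QuantumComplexity
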